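import Literature.Analysis.UnboundedOperators.HeatKernelHeatEquation
import Literature.Analysis.FluidPDE.SpaceTimeCalculus
import Mathlib.MeasureTheory.Integral.IntegralEqImproper
import HarnessLib

/-!
# The backward caloric Duhamel integral `U(s) = ∫ₛ^∞ e^{ν(t-s)Δ} Θ(t) dt` of a space–time test field

Analysis/FluidPDE support file (calculus of the heat semigroup on space–time test data). It
serves the local-uniqueness step of the Furioli–Lemarié-Rieusset–Terraneo theorem
(`Literature.Analysis.FluidPDE.kato_unique` via `Literature/Analysis/FluidPDE/KatoUniqueness`), whose proof in the
tree's duality formulation tests the difference of two mild solutions against the *backward*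
caloric Duhamel integral of a space–time field `Θ` and needs the `L²` energy / maximal
regularity estimates of Lemarié-Rieusset 2016, Prop. 4.3 (B)–(C) (p. 74) for it; those
estimates (file `HeatDuhamelEnergy`) rest on the pointwise calculus proved here.

Let `E` be a finite-dimensional real inner product space with Lebesgue measure, `F` a real
Banach space, `ν > 0`, and `Θ : ℝ → E → F` a space–time test field on all of `ℝ × E`
(accepted `Fluid.IsSpaceTimeTestOn ⊤ Θ`: `uncurry Θ ∈ C_c^∞(ℝ × E; F)`). We define

* `Literature.Fluid.heatDuhamelBack ν Θ s x = ∫_{σ > 0} (e^{νσΔ} Θ(s + σ))(x) dσ`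
  (`= ∫ₛ^∞ (e^{ν(t-s)Δ} Θ(t))(x) dt`), written `𝒰[Θ](s)(x)` below, with the accepted caloric
  extension `Literature.Analysis.UnboundedOperators.heatExtension` at the positive times `νσ` (so that the tree's junk value of
  `heatExtension` at time `0` never enters),

and prove, for space–time test fields `Θ`:

* closure of the class under `∂ₜ` (`timeDeriv`), `∂ᵥ`, `D`, `Δ` (`IsSpaceTimeTestOn.timeDeriv_top`,
  `.fderiv_apply_top`, `.fderiv_top`, `.laplacian_top`);
* `𝒰[Θ]` is jointly continuous, bounded by `‖Θ‖_∞ (b - s)₊` (`[a, b]` the time support),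
  zero for `s ≥ b`, integrable and square integrable in `x`
  (`continuous_heatDuhamelBack`, `norm_heatDuhamelBack_le`, `heatDuhamelBack_eq_zero_of_le`,
  `integrable_heatDuhamelBack`, `memLp_two_heatDuhamelBack`);
* **derivatives fall on the data**: `D(𝒰[Θ](s)) = 𝒰[DΘ](s)` (`hasFDerivAt_heatDuhamelBack`,
  `fderiv_heatDuhamelBack_apply`), `𝒰[Θ](s) ∈ C²` (`contDiff_two_heatDuhamelBack`),
  `Δ(𝒰[Θ](s)) = 𝒰[ΔΘ](s)` (`laplacian_heatDuhamelBack`), and in time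
  `∂ₛ 𝒰[Θ](s)(x) = 𝒰[∂ₜΘ](s)(x)` (`hasDerivAt_heatDuhamelBack_time`; in the substituted form the
  domain of integration does not move with `s`);
* **the backward heat equation** `𝒰[∂ₜΘ] + ν 𝒰[ΔΘ] = -Θ`, i.e. `∂ₛU + νΔU = -Θ`
  (`heatDuhamelBack_backward_heat`): the integrand `σ ↦ (e^{νσΔ}Θ(s + σ))(x)` extends
  continuously to `σ = 0` with value `Θ(s)(x)` (parabolic scaling, tree
  `heatExtension_eq_integral_heatKernel_one`), vanishes for large `σ`, and on `σ > 0` has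
  derivative `(e^{νσΔ}∂ₜΘ(s + σ))(x) + ν (e^{νσΔ}ΔΘ(s + σ))(x)` by the chain rule along
  `σ ↦ (s + σ, νσ)` applied to the jointly differentiable map `(t, α) ↦ (e^{αΔ}Θ(t))(x)`
  (`hasFDerivAt_heatExtension_uncurry`: dominated differentiation of `∫ G_α(x - y) Θ(t, y) dy`
  with the tree's Gaussian domination of `∂_α G_α` and the heat equation
  `∂_α e^{αΔ}g = e^{αΔ}Δg`); then `∫₀^∞` of the derivative is `-Θ(s)(x)`
  (`MeasureTheory.integral_Ioi_of_hasDerivAt_of_tendsto`).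

This is the classical statement that `U` solves the adjoint (backward) heat problem with source
`Θ` and final value `0` (Lemarié-Rieusset 2016, Prop. 4.3, proof of (B), p. 75:
"`∂ₜ(|U|²) = 2U∂ₜU = 2νUΔU + 2U div g`", after time reversal; Evans, *PDE*, §2.3.1, Thm. 2,
Duhamel's principle for the nonhomogeneous heat equation).

## Mathlib / tree search

Mathlib (this pin) has no heat semigroup on functions and no Duhamel formula (searched
`Duhamel`, `heat` in `Analysis/`); it supplies dominated differentiation
(`hasFDerivAt_integral_of_dominated_of_fderiv_le`, `hasDerivAt_integral_of_dominated_loc_of_deriv_le`),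
dominated continuity (`continuous_of_dominated`, `continuousAt_of_dominated`), the improper
fundamental theorem (`integral_Ioi_of_hasDerivAt_of_tendsto`) and Tonelli
(`integrable_prod_iff'`). From the tree: the caloric extension and its calculus
(`UnboundedOperators/HeatKernel*`: `heatExtension`, `hasDerivAt_heatKernel_time`,
`exists_abs_timeWeight_mul_heatKernel_le`, `laplacian_heatExtension_eq_integral`,
`laplacian_heatExtension_of_hasCompactSupport`, `hasFDerivAt_heatExtension_of_hasCompactSupport`,
`heatExtension_eq_integral_heatKernel_one`, `norm_heatExtension_le`,
`lintegral_enorm_heatExtension_le`), space–time test fields and slice calculus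
(`FluidPDE/WeakSolution`, `ClassicalSolutionCalculus`, `SpaceTimeCalculus`:
`IsSpaceTimeTestOn`, `timeDeriv`, `IsSmoothSpaceTimeOn.isSmoothSpaceTimeOn_deriv`/`_fderiv_*`).

## References

* P. G. Lemarié-Rieusset, *The Navier–Stokes problem in the 21st century*, CRC Press 2016,
  Prop. 4.3 (energy estimates for the heat kernel: (A) free flow, (B) Duhamel term,
  (C) maximal regularity), pp. 74–75. Bib key `LemarieRieusset2016`.
* L. C. Evans, *Partial Differential Equations*, 2nd ed. (AMS 2010), §2.3.1, Thm. 1 and Thm. 2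
  (Duhamel's principle). Bib key `Evans2010`.
-/

open MeasureTheory Filter Topology Set InnerProductSpace Metric Function TopologicalSpace
open scoped Real ENNReal NNReal Laplacian ContDiff

noncomputable section

namespace Literature.Analysis.FluidPDE

variable {E : Type*} [NormedAddCommGroup E] [InnerProductSpace ℝ E] [FiniteDimensional ℝ E]
  [MeasurableSpace E] [BorelSpace E]
variable {F : Type*} [NormedAddCommGroup F] [NormedSpace ℝ F]

/-! ### Space–time test fields: derived fields, bounds, supports -/

section TestField

omit [MeasurableSpace E] [BorelSpace E] [InnerProductSpace ℝ E] [FiniteDimensional ℝ E] in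
/-- Outside the support of a space–time test field its time derivative vanishes. [folklore] -/
theorem IsSpaceTimeTestOn.timeDeriv_eq_zero_of_notMem {ψ : ℝ → E → F}
    {t : ℝ} {x : E} (h : (t, x) ∉ tsupport (uncurry ψ)) : timeDeriv ψ t x = 0 := by
  have h0 : uncurry ψ =ᶠ[𝓝 (t, x)] 0 := notMem_tsupport_iff_eventuallyEq.1 h
  have hc : Continuous fun s : ℝ => (s, x) := continuous_id.prodMk continuous_const
  have h1 : (fun s => ψ s x) =ᶠ[𝓝 t] fun _ => (0 : F) := (hc.tendsto t).eventually h0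
  rw [timeDeriv, h1.deriv_eq, deriv_const]

omit [MeasurableSpace E] [BorelSpace E] [FiniteDimensional ℝ E] in
/-- Outside the support of a space–time test field its slice derivatives vanish. [folklore] -/
theorem IsSpaceTimeTestOn.fderiv_slice_eq_zero_of_notMem {ψ : ℝ → E → F}
    {t : ℝ} {x : E} (h : (t, x) ∉ tsupport (uncurry ψ)) : fderiv ℝ (ψ t) x = 0 := by
  have h0 : uncurry ψ =ᶠ[𝓝 (t, x)] 0 := notMem_tsupport_iff_eventuallyEq.1 h
  have hc : Continuous fun y : E => (t, y) := continuous_const.prodMk continuous_id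
  have h1 : ψ t =ᶠ[𝓝 x] fun _ => (0 : F) := (hc.tendsto x).eventually h0
  rw [h1.fderiv_eq, fderiv_fun_const, Pi.zero_apply]

omit [MeasurableSpace E] [BorelSpace E] [FiniteDimensional ℝ E] in
/-- The time derivative of a space–time test field on `ℝ × E` is a space–time test field. [folklore] -/
theorem IsSpaceTimeTestOn.timeDeriv_top {ψ : ℝ → E → F}
    (hψ : IsSpaceTimeTestOn (⊤ : Opens (ℝ × E)) ψ) :
    IsSpaceTimeTestOn (⊤ : Opens (ℝ × E)) (timeDeriv ψ) where
  contDiff := by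
    have h := (hψ.isSmoothSpaceTimeOn univ).isSmoothSpaceTimeOn_deriv isOpen_univ
    rw [IsSmoothSpaceTimeOn, univ_prod_univ, contDiffOn_univ] at h
    exact h
  hasCompactSupport := HasCompactSupport.intro hψ.hasCompactSupport fun p hp => by
    obtain ⟨t, x⟩ := p
    exact IsSpaceTimeTestOn.timeDeriv_eq_zero_of_notMem hp
  tsupport_subset := by simp

omit [MeasurableSpace E] [BorelSpace E] [FiniteDimensional ℝ E] in
/-- The spatial directional derivatives of a space–time test field on `ℝ × E` are space–time
test fields. [folklore] -/
theorem IsSpaceTimeTestOn.fderiv_apply_top {ψ : ℝ → E → F}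
    (hψ : IsSpaceTimeTestOn (⊤ : Opens (ℝ × E)) ψ) (v : E) :
    IsSpaceTimeTestOn (⊤ : Opens (ℝ × E)) (fun t x => fderiv ℝ (ψ t) x v) where
  contDiff := by
    have h := (hψ.isSmoothSpaceTimeOn univ).isSmoothSpaceTimeOn_fderiv_apply isOpen_univ v
    rw [IsSmoothSpaceTimeOn, univ_prod_univ, contDiffOn_univ] at h
    exact h
  hasCompactSupport := HasCompactSupport.intro hψ.hasCompactSupport fun p hp => by
    obtain ⟨t, x⟩ := p
    simp [IsSpaceTimeTestOn.fderiv_slice_eq_zero_of_notMem hp]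
  tsupport_subset := by simp

omit [MeasurableSpace E] [BorelSpace E] in
/-- The Laplacian as the sum of pure second directional derivatives over an orthonormal frame,
`Δ v (x) = Σᵢ ∂ᵢ∂ᵢ v (x)`, for `C²` fields with values in a normed space (the tree's
`Fluid.laplacian_eq_sum_fderiv_fderiv` asks for an inner product target). [folklore] -/
theorem laplacian_eq_sum_fderiv_fderiv_normed {ι : Type*} [Fintype ι] (b : OrthonormalBasis ι ℝ E)
    {v : E → F} (hv : ContDiff ℝ 2 v) (x : E) :
    (Δ v) x = ∑ i, fderiv ℝ (fun y => fderiv ℝ v y (b i)) x (b i) := by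
  rw [laplacian_eq_iteratedFDeriv_orthonormalBasis v b]
  refine Finset.sum_congr rfl fun i _ => ?_
  have hd : DifferentiableAt ℝ (fderiv ℝ v) x :=
    ((hv.fderiv_right (m := 1) le_rfl).differentiable one_ne_zero) x
  rw [iteratedFDeriv_two_apply, fderiv_clm_apply hd (differentiableAt_const _)]
  simp

omit [MeasurableSpace E] [BorelSpace E] in
/-- The slicewise Laplacian of a space–time test field on `ℝ × E` is a space–time test field
(`Δ = Σᵢ ∂ᵢ∂ᵢ` over an orthonormal frame). [folklore] -/
theorem IsSpaceTimeTestOn.laplacian_top {ψ : ℝ → E → F}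
    (hψ : IsSpaceTimeTestOn (⊤ : Opens (ℝ × E)) ψ) :
    IsSpaceTimeTestOn (⊤ : Opens (ℝ × E)) (fun t => Δ (ψ t)) := by
  set b := stdOrthonormalBasis ℝ E
  have h2 : ∀ t, ContDiff ℝ 2 (ψ t) := fun t => contDiff_infty.1 (hψ.contDiff_slice t) 2
  have heq : (fun t => Δ (ψ t)) = fun t x =>
      ∑ i, fderiv ℝ (fun y => fderiv ℝ (ψ t) y (b i)) x (b i) := by
    funext t
    funext x
    exact laplacian_eq_sum_fderiv_fderiv_normed b (h2 t) x
  rw [heq]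
  have hi : ∀ i, IsSpaceTimeTestOn (⊤ : Opens (ℝ × E))
      (fun t x => fderiv ℝ (fun y => fderiv ℝ (ψ t) y (b i)) x (b i)) := fun i =>
    (hψ.fderiv_apply_top (b i)).fderiv_apply_top (b i)
  refine ⟨?_, ?_, by simp⟩
  · have : uncurry (fun t x => ∑ i, fderiv ℝ (fun y => fderiv ℝ (ψ t) y (b i)) x (b i)) =
        fun p => ∑ i, uncurry (fun t x => fderiv ℝ (fun y => fderiv ℝ (ψ t) y (b i)) x (b i)) p := by
      funext p; rfl
    rw [this]
    exact ContDiff.sum fun i _ => (hi i).contDiff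
  · refine HasCompactSupport.intro hψ.hasCompactSupport fun p hp => ?_
    obtain ⟨t, x⟩ := p
    simp only [uncurry_apply_pair]
    refine Finset.sum_eq_zero fun i _ => ?_
    have hsub : tsupport (uncurry fun t x => fderiv ℝ (ψ t) x (b i)) ⊆ tsupport (uncurry ψ) := by
      refine closure_minimal (fun q hq => ?_) (isClosed_tsupport _)
      obtain ⟨t', x'⟩ := q
      by_contra hq'
      exact hq (by simp [IsSpaceTimeTestOn.fderiv_slice_eq_zero_of_notMem hq'])
    have hp' : (t, x) ∉ tsupport (uncurry fun t x => fderiv ℝ (ψ t) x (b i)) := fun h => hp (hsub h)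
    simp [IsSpaceTimeTestOn.fderiv_slice_eq_zero_of_notMem hp']

omit [MeasurableSpace E] [BorelSpace E] [FiniteDimensional ℝ E] in
/-- The operator-valued spatial derivative `(t, x) ↦ D(ψ t)(x)` of a space–time test field on
`ℝ × E` is a space–time test field. [folklore] -/
theorem IsSpaceTimeTestOn.fderiv_top {ψ : ℝ → E → F}
    (hψ : IsSpaceTimeTestOn (⊤ : Opens (ℝ × E)) ψ) :
    IsSpaceTimeTestOn (⊤ : Opens (ℝ × E)) (fun t x => fderiv ℝ (ψ t) x) where
  contDiff := by
    have h := (hψ.isSmoothSpaceTimeOn univ).isSmoothSpaceTimeOn_fderiv_of_isOpen isOpen_univ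
    rw [IsSmoothSpaceTimeOn, univ_prod_univ, contDiffOn_univ] at h
    exact h
  hasCompactSupport := HasCompactSupport.intro hψ.hasCompactSupport fun p hp => by
    obtain ⟨t, x⟩ := p
    simp [IsSpaceTimeTestOn.fderiv_slice_eq_zero_of_notMem hp]
  tsupport_subset := by simp

omit [MeasurableSpace E] [BorelSpace E] [FiniteDimensional ℝ E] in
/-- If `ψ(t) = 0` then `D(ψ t) = 0`: derived fields inherit the time support. [folklore] -/
theorem fderiv_slice_eq_zero_of_eq_zero {ψ : ℝ → E → F} {t : ℝ} (h : ψ t = 0) :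
    (fun x => fderiv ℝ (ψ t) x) = 0 := by
  funext x
  rw [h]
  exact fderiv_const_apply 0  -- fderiv of the zero function

omit [MeasurableSpace E] [BorelSpace E] [FiniteDimensional ℝ E] in
/-- A space–time test field is bounded. [folklore] -/
theorem IsSpaceTimeTestOn.exists_norm_le {ψ : ℝ → E → F}
    (hψ : IsSpaceTimeTestOn (⊤ : Opens (ℝ × E)) ψ) : ∃ M : ℝ, 0 ≤ M ∧ ∀ t x, ‖ψ t x‖ ≤ M := by
  obtain ⟨M, hM⟩ := hψ.contDiff.continuous.bounded_above_of_compact_support hψ.hasCompactSupport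
  exact ⟨max M 0, le_max_right _ _, fun t x => (hM (t, x)).trans (le_max_left _ _)⟩

omit [MeasurableSpace E] [BorelSpace E] [FiniteDimensional ℝ E] in
/-- A space–time test field vanishes outside a bounded time interval. [folklore] -/
theorem IsSpaceTimeTestOn.exists_time_support {ψ : ℝ → E → F}
    (hψ : IsSpaceTimeTestOn (⊤ : Opens (ℝ × E)) ψ) :
    ∃ a b : ℝ, ∀ t, t ∉ Icc a b → ψ t = 0 := by
  have h1 : IsCompact (Prod.fst '' tsupport (uncurry ψ)) :=
    hψ.hasCompactSupport.image continuous_fst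
  obtain ⟨b, hb⟩ := h1.isBounded.bddAbove
  obtain ⟨a, ha⟩ := h1.isBounded.bddBelow
  refine ⟨a, b, fun t ht => funext fun x => ?_⟩
  by_contra hx
  have hmem : (t, x) ∈ tsupport (uncurry ψ) := subset_tsupport _ hx
  exact ht ⟨ha ⟨(t, x), hmem, rfl⟩, hb ⟨(t, x), hmem, rfl⟩⟩

omit [MeasurableSpace E] [BorelSpace E] [FiniteDimensional ℝ E] in
/-- Joint continuity of a space–time test field as a function on `ℝ × E`. [folklore] -/
theorem IsSpaceTimeTestOn.continuous_uncurry {ψ : ℝ → E → F}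
    (hψ : IsSpaceTimeTestOn (⊤ : Opens (ℝ × E)) ψ) : Continuous (uncurry ψ) :=
  hψ.contDiff.continuous

end TestField

/-! ### The backward caloric Duhamel integral -/

section Duhamel

/-- The **backward caloric Duhamel integral** of a space–time field `Θ : ℝ → E → F` with
viscosity `ν`:
`heatDuhamelBack ν Θ s x = ∫_{σ > 0} (e^{νσΔ} Θ(s + σ))(x) dσ = ∫ₛ^∞ (e^{ν(t-s)Δ} Θ(t))(x) dt`,
the solution of the backward heat problem `∂ₛU + νΔU = -Θ`, `U(+∞) = 0` (the adjoint of the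
forward Duhamel integral `∫₀ᵗ W_{ν(t-s)} * Θ(s) ds` of Lemarié-Rieusset 2016, Prop. 4.3 B–C,
p. 74, which is obtained by time reversal). Written with the accepted caloric extension
`Literature.Analysis.UnboundedOperators.heatExtension` at the positive times `νσ`; a Bochner integral, `0` if divergent (it
converges absolutely for space–time test fields and `0 < ν`). [cite: LemarieRieusset2016, Prop. 4.3 (B), (C), p. 74] -/
def heatDuhamelBack (ν : ℝ) (Θ : ℝ → E → F) (s : ℝ) (x : E) : F :=
  ∫ σ in Ioi (0 : ℝ), UnboundedOperators.heatExtension (Θ (s + σ)) (ν * σ) x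

/-- Unfolding `heatDuhamelBack`. [folklore] -/
theorem heatDuhamelBack_apply (ν : ℝ) (Θ : ℝ → E → F) (s : ℝ) (x : E) :
    heatDuhamelBack ν Θ s x = ∫ σ in Ioi (0 : ℝ), UnboundedOperators.heatExtension (Θ (s + σ)) (ν * σ) x := rfl

variable {ν : ℝ} {Θ : ℝ → E → F}

/-- **The scaled representation is jointly continuous**: the map
`(s, σ, x) ↦ ∫ G_1(z) • Θ(s + σ)(x - √(νσ) z) dz`, which for `σ > 0` is the integrand
`(e^{νσΔ} Θ(s + σ))(x)` of the Duhamel integral and for `σ ≤ 0` is `Θ(s + σ)(x)`, is continuous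
on `ℝ × ℝ × E` (dominated convergence with the majorant `‖Θ‖_∞ G_1`; Evans, *PDE*, §2.3.1,
Thm. 1 (iii)). [folklore] -/
theorem IsSpaceTimeTestOn.continuous_scaledIntegrand
    (hΘ : IsSpaceTimeTestOn (⊤ : Opens (ℝ × E)) Θ) (ν : ℝ) :
    Continuous fun p : ℝ × ℝ × E =>
      ∫ z, UnboundedOperators.heatKernel 1 z • Θ (p.1 + p.2.1) (p.2.2 - Real.sqrt (ν * p.2.1) • z) := by
  obtain ⟨M, hM0, hM⟩ := hΘ.exists_norm_le
  have hK : Continuous (UnboundedOperators.heatKernel (E := E) 1) := UnboundedOperators.continuous_heatKernel 1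
  have hΘc : Continuous (uncurry Θ) := hΘ.continuous_uncurry
  have harg : ∀ z : E, Continuous fun p : ℝ × ℝ × E =>
      Θ (p.1 + p.2.1) (p.2.2 - Real.sqrt (ν * p.2.1) • z) := fun z => by
    have h1 : Continuous fun p : ℝ × ℝ × E => (p.1 + p.2.1, p.2.2 - Real.sqrt (ν * p.2.1) • z) := by
      fun_prop
    exact hΘc.comp h1
  have hslice : ∀ p : ℝ × ℝ × E, Continuous fun z : E =>
      Θ (p.1 + p.2.1) (p.2.2 - Real.sqrt (ν * p.2.1) • z) := fun p =>
    (hΘ.contDiff_slice _).continuous.comp (continuous_const.sub (continuous_const.smul continuous_id))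
  refine continuous_of_dominated (bound := fun z => UnboundedOperators.heatKernel 1 z * M) ?_ ?_ ?_ ?_
  · intro p
    exact (hK.smul (hslice p)).aestronglyMeasurable
  · intro p
    exact Eventually.of_forall fun z => by
      rw [norm_smul, Real.norm_of_nonneg (UnboundedOperators.heatKernel_pos one_pos z).le]
      exact mul_le_mul_of_nonneg_left (hM _ _) (UnboundedOperators.heatKernel_pos one_pos z).le
  · exact (UnboundedOperators.integrable_heatKernel_holds one_pos).mul_const M
  · exact Eventually.of_forall fun z => continuous_const.smul (harg z)

/-! ### The Duhamel integrand `σ ↦ (e^{νσΔ} Θ(s + σ))(x)` on `σ > 0` -/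

/-- For `σ > 0` the Duhamel integrand is the scaled caloric integral. [folklore] -/
theorem duhamelIntegrand_eq_scaled (hν : 0 < ν) {σ : ℝ} (hσ : 0 < σ) (s : ℝ) (x : E) :
    UnboundedOperators.heatExtension (Θ (s + σ)) (ν * σ) x =
      ∫ z, UnboundedOperators.heatKernel 1 z • Θ (s + σ) (x - Real.sqrt (ν * σ) • z) :=
  UnboundedOperators.heatExtension_eq_integral_heatKernel_one (mul_pos hν hσ) _ x

/-- Joint continuity of the Duhamel integrand `(s, σ, x) ↦ (e^{νσΔ} Θ(s + σ))(x)` on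
`{σ > 0}`. [folklore] -/
theorem IsSpaceTimeTestOn.continuousOn_duhamelIntegrand
    (hΘ : IsSpaceTimeTestOn (⊤ : Opens (ℝ × E)) Θ) (hν : 0 < ν) :
    ContinuousOn (fun p : ℝ × ℝ × E => UnboundedOperators.heatExtension (Θ (p.1 + p.2.1)) (ν * p.2.1) p.2.2)
      {p | 0 < p.2.1} :=
  (hΘ.continuous_scaledIntegrand ν).continuousOn.congr fun _ hp =>
    duhamelIntegrand_eq_scaled hν hp _ _

/-- Continuity in `σ > 0` of the Duhamel integrand at fixed `(s, x)`. [folklore] -/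
theorem IsSpaceTimeTestOn.continuousOn_duhamelIntegrand_right
    (hΘ : IsSpaceTimeTestOn (⊤ : Opens (ℝ × E)) Θ) (hν : 0 < ν) (s : ℝ) (x : E) :
    ContinuousOn (fun σ : ℝ => UnboundedOperators.heatExtension (Θ (s + σ)) (ν * σ) x) (Ioi 0) := by
  have hc : Continuous fun σ : ℝ => ((s, σ, x) : ℝ × ℝ × E) := by fun_prop
  have h := ContinuousOn.comp (g := fun p : ℝ × ℝ × E =>
      UnboundedOperators.heatExtension (Θ (p.1 + p.2.1)) (ν * p.2.1) p.2.2)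
    (f := fun σ : ℝ => ((s, σ, x) : ℝ × ℝ × E)) (s := Ioi 0) (hΘ.continuousOn_duhamelIntegrand hν)
    hc.continuousOn (fun σ hσ => show 0 < σ from hσ)
  simpa only [Function.comp_def] using h

/-- Continuity in `x` of the Duhamel integrand at fixed `s` and `σ > 0`. [folklore] -/
theorem IsSpaceTimeTestOn.continuous_duhamelIntegrand_space
    (hΘ : IsSpaceTimeTestOn (⊤ : Opens (ℝ × E)) Θ) (hν : 0 < ν) (s : ℝ) {σ : ℝ} (hσ : 0 < σ) :
    Continuous fun x : E => UnboundedOperators.heatExtension (Θ (s + σ)) (ν * σ) x := by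
  have hc : Continuous fun x : E => ((s, σ, x) : ℝ × ℝ × E) := by fun_prop
  have h := ContinuousOn.comp (g := fun p : ℝ × ℝ × E =>
      UnboundedOperators.heatExtension (Θ (p.1 + p.2.1)) (ν * p.2.1) p.2.2)
    (f := fun x : E => ((s, σ, x) : ℝ × ℝ × E)) (s := univ) (hΘ.continuousOn_duhamelIntegrand hν)
    hc.continuousOn (fun x _ => show 0 < σ from hσ)
  rw [continuousOn_univ] at h
  simpa only [Function.comp_def] using h

/-- The Duhamel integrand is bounded by `‖Θ‖_∞` (maximum principle for `e^{σΔ}`). [folklore] -/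
theorem norm_duhamelIntegrand_le {M : ℝ} (hM : ∀ t x, ‖Θ t x‖ ≤ M) (hν : 0 < ν) {σ : ℝ}
    (hσ : 0 < σ) (s : ℝ) (x : E) : ‖UnboundedOperators.heatExtension (Θ (s + σ)) (ν * σ) x‖ ≤ M :=
  UnboundedOperators.norm_heatExtension_le (hM _) (mul_pos hν hσ) x

/-- Past the time support the Duhamel integrand vanishes: if `Θ(t) = 0` for `t ∉ [a, b]` then
`(e^{νσΔ} Θ(s + σ))(x) = 0` for `σ > b - s`. [folklore] -/
theorem duhamelIntegrand_eq_zero {a b : ℝ} (hab : ∀ t, t ∉ Icc a b → Θ t = 0) {s σ : ℝ}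
    (hσ : b - s < σ) (x : E) : UnboundedOperators.heatExtension (Θ (s + σ)) (ν * σ) x = 0 := by
  have h : Θ (s + σ) = fun _ => (0 : F) := by
    rw [hab (s + σ) fun h => by linarith [h.2]]
    rfl
  rw [h, UnboundedOperators.heatExtension_zero_fun]
  rfl

/-- The Duhamel integrand is integrable on `σ > 0` (bounded, continuous, and zero for large
`σ`). [folklore] -/
theorem IsSpaceTimeTestOn.integrableOn_duhamelIntegrand
    (hΘ : IsSpaceTimeTestOn (⊤ : Opens (ℝ × E)) Θ) (hν : 0 < ν) (s : ℝ) (x : E) :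
    IntegrableOn (fun σ : ℝ => UnboundedOperators.heatExtension (Θ (s + σ)) (ν * σ) x) (Ioi 0) volume := by
  obtain ⟨M, hM0, hM⟩ := hΘ.exists_norm_le
  obtain ⟨a, b, hab⟩ := hΘ.exists_time_support
  set L : ℝ := max (b - s) 0 + 1 with hL_def
  have hL : 0 < L := by positivity
  have hcont := hΘ.continuousOn_duhamelIntegrand_right hν s x
  have h1 : IntegrableOn (fun σ : ℝ => UnboundedOperators.heatExtension (Θ (s + σ)) (ν * σ) x) (Ioc 0 L) volume := by
    haveI : IsFiniteMeasure (volume.restrict (Ioc (0 : ℝ) L)) :=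
      isFiniteMeasure_restrict.2 measure_Ioc_lt_top.ne
    refine Integrable.mono' (integrable_const M)
      ((hcont.mono Ioc_subset_Ioi_self).aestronglyMeasurable measurableSet_Ioc) ?_
    refine (ae_restrict_iff' measurableSet_Ioc).2 (Eventually.of_forall fun σ hσ => ?_)
    exact norm_duhamelIntegrand_le hM hν hσ.1 s x
  have h2 : IntegrableOn (fun σ : ℝ => UnboundedOperators.heatExtension (Θ (s + σ)) (ν * σ) x) (Ioi L) volume := by
    refine (integrableOn_zero).congr_fun (fun σ hσ => ?_) measurableSet_Ioi
    refine (duhamelIntegrand_eq_zero hab ?_ x).symm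
    have : b - s < L := by
      have := le_max_left (b - s) 0
      linarith
    exact this.trans hσ
  rw [← Ioc_union_Ioi_eq_Ioi hL.le]
  exact h1.union h2

/-- The Duhamel integral over `σ > 0` is the integral over any `(0, L]` with `L ≥ b - s`, if
`Θ(t) = 0` for `t ∉ [a, b]`. [folklore] -/
theorem IsSpaceTimeTestOn.heatDuhamelBack_eq_setIntegral_Ioc
    (hΘ : IsSpaceTimeTestOn (⊤ : Opens (ℝ × E)) Θ) (hν : 0 < ν) {a b : ℝ}
    (hab : ∀ t, t ∉ Icc a b → Θ t = 0) {s L : ℝ} (hL0 : 0 ≤ L) (hL : b - s ≤ L) (x : E) :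
    heatDuhamelBack ν Θ s x = ∫ σ in Ioc 0 L, UnboundedOperators.heatExtension (Θ (s + σ)) (ν * σ) x := by
  have hint := hΘ.integrableOn_duhamelIntegrand hν s x
  rw [heatDuhamelBack_apply, ← Ioc_union_Ioi_eq_Ioi hL0,
    setIntegral_union (Ioc_disjoint_Ioi le_rfl) measurableSet_Ioi
      (hint.mono_set Ioc_subset_Ioi_self) (hint.mono_set (Ioi_subset_Ioi hL0))]
  have h0 : ∫ σ in Ioi L, UnboundedOperators.heatExtension (Θ (s + σ)) (ν * σ) x = 0 :=
    setIntegral_eq_zero_of_forall_eq_zero fun σ hσ =>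
      duhamelIntegrand_eq_zero hab (hL.trans_lt hσ) x
  rw [h0, add_zero]

/-- **Uniform bound**: `‖U(s)(x)‖ ≤ ‖Θ‖_∞ (b - s)₊` where `[a, b]` contains the time support
of `Θ`. [folklore] -/
theorem IsSpaceTimeTestOn.norm_heatDuhamelBack_le
    (hΘ : IsSpaceTimeTestOn (⊤ : Opens (ℝ × E)) Θ) (hν : 0 < ν) {M : ℝ}
    (hM : ∀ t x, ‖Θ t x‖ ≤ M) {a b : ℝ} (hab : ∀ t, t ∉ Icc a b → Θ t = 0) (s : ℝ) (x : E) :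
    ‖heatDuhamelBack ν Θ s x‖ ≤ M * max (b - s) 0 := by
  rw [hΘ.heatDuhamelBack_eq_setIntegral_Ioc hν hab (le_max_right _ _) (le_max_left _ _) x]
  have hfin : volume (Ioc (0 : ℝ) (max (b - s) 0)) < ⊤ := measure_Ioc_lt_top
  have h := norm_setIntegral_le_of_norm_le_const hfin
    (fun σ hσ => norm_duhamelIntegrand_le hM hν hσ.1 s x)
  rwa [Real.volume_real_Ioc_of_le (le_max_right _ _), sub_zero] at h

/-- Past the time support the Duhamel integral vanishes: `U(s) = 0` for `s ≥ b`. [folklore] -/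
theorem IsSpaceTimeTestOn.heatDuhamelBack_eq_zero_of_le
    (hΘ : IsSpaceTimeTestOn (⊤ : Opens (ℝ × E)) Θ) (hν : 0 < ν) {a b : ℝ}
    (hab : ∀ t, t ∉ Icc a b → Θ t = 0) {s : ℝ} (hs : b ≤ s) (x : E) :
    heatDuhamelBack ν Θ s x = 0 := by
  rw [hΘ.heatDuhamelBack_eq_setIntegral_Ioc hν hab le_rfl (by linarith) x]
  simp


/-! ### Continuity and spatial derivatives of the Duhamel integral -/

/-- **Joint continuity** of `(s, x) ↦ U(s)(x)` (dominated convergence in `σ`). [folklore] -/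
theorem IsSpaceTimeTestOn.continuous_heatDuhamelBack
    (hΘ : IsSpaceTimeTestOn (⊤ : Opens (ℝ × E)) Θ) (hν : 0 < ν) :
    Continuous fun q : ℝ × E => heatDuhamelBack ν Θ q.1 q.2 := by
  obtain ⟨M, hM0, hM⟩ := hΘ.exists_norm_le
  obtain ⟨a, b, hab⟩ := hΘ.exists_time_support
  refine continuous_iff_continuousAt.2 fun q₀ => ?_
  obtain ⟨s₀, x₀⟩ := q₀
  set L : ℝ := max (b - s₀ + 1) 0 with hL_def
  -- the integrand and its bound near `s₀`
  have hmeas : ∀ q : ℝ × E, AEStronglyMeasurable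
      (fun σ : ℝ => UnboundedOperators.heatExtension (Θ (q.1 + σ)) (ν * σ) q.2) (volume.restrict (Ioi 0)) := fun q =>
    (hΘ.continuousOn_duhamelIntegrand_right hν q.1 q.2).aestronglyMeasurable measurableSet_Ioi
  have hnear : ∀ᶠ q : ℝ × E in 𝓝 (s₀, x₀), s₀ - 1 < q.1 := by
    have : Ioi (s₀ - 1) ×ˢ (univ : Set E) ∈ 𝓝 (s₀, x₀) :=
      prod_mem_nhds (Ioi_mem_nhds (by linarith)) univ_mem
    filter_upwards [this] with q hq using hq.1
  have hbound : ∀ᶠ q : ℝ × E in 𝓝 (s₀, x₀), ∀ᵐ σ ∂(volume.restrict (Ioi (0 : ℝ))),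
      ‖UnboundedOperators.heatExtension (Θ (q.1 + σ)) (ν * σ) q.2‖ ≤ (Ioc (0 : ℝ) L).indicator (fun _ => M) σ := by
    filter_upwards [hnear] with q hq
    refine (ae_restrict_iff' measurableSet_Ioi).2 (Eventually.of_forall fun σ hσ => ?_)
    by_cases hσL : σ ≤ L
    · rw [indicator_of_mem (show σ ∈ Ioc (0 : ℝ) L from ⟨hσ, hσL⟩)]
      exact norm_duhamelIntegrand_le hM hν hσ q.1 q.2
    · rw [indicator_of_notMem (fun h => hσL h.2), duhamelIntegrand_eq_zero hab ?_ q.2, norm_zero]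
      have h1 : b - s₀ + 1 ≤ L := le_max_left _ _
      have h2 := not_le.1 hσL
      linarith
  have hint : Integrable ((Ioc (0 : ℝ) L).indicator fun _ => M) (volume.restrict (Ioi 0)) := by
    refine Integrable.integrableOn ?_
    refine (integrable_indicator_iff measurableSet_Ioc).2 ?_
    haveI : IsFiniteMeasure (volume.restrict (Ioc (0 : ℝ) L)) :=
      isFiniteMeasure_restrict.2 measure_Ioc_lt_top.ne
    exact integrable_const M
  have hcont : ∀ᵐ σ ∂(volume.restrict (Ioi (0 : ℝ))),
      ContinuousAt (fun q : ℝ × E => UnboundedOperators.heatExtension (Θ (q.1 + σ)) (ν * σ) q.2) (s₀, x₀) := by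
    refine (ae_restrict_iff' measurableSet_Ioi).2 (Eventually.of_forall fun σ hσ => ?_)
    have hc : Continuous fun q : ℝ × E => ((q.1, σ, q.2) : ℝ × ℝ × E) := by fun_prop
    have h := ContinuousOn.comp (g := fun p : ℝ × ℝ × E =>
        UnboundedOperators.heatExtension (Θ (p.1 + p.2.1)) (ν * p.2.1) p.2.2)
      (f := fun q : ℝ × E => ((q.1, σ, q.2) : ℝ × ℝ × E)) (s := univ)
      (hΘ.continuousOn_duhamelIntegrand hν) hc.continuousOn (fun q _ => show 0 < σ from hσ)
    rw [continuousOn_univ] at h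
    have h' : Continuous fun q : ℝ × E => UnboundedOperators.heatExtension (Θ (q.1 + σ)) (ν * σ) q.2 := by
      simpa only [Function.comp_def] using h
    exact h'.continuousAt
  exact continuousAt_of_dominated (Eventually.of_forall hmeas) hbound hint hcont

/-- Continuity of `x ↦ U(s)(x)`. [folklore] -/
theorem IsSpaceTimeTestOn.continuous_heatDuhamelBack_space
    (hΘ : IsSpaceTimeTestOn (⊤ : Opens (ℝ × E)) Θ) (hν : 0 < ν) (s : ℝ) :
    Continuous (heatDuhamelBack ν Θ s) :=
  (hΘ.continuous_heatDuhamelBack hν).comp (continuous_const.prodMk continuous_id)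

/-- Continuity of `s ↦ U(s)(x)`. [folklore] -/
theorem IsSpaceTimeTestOn.continuous_heatDuhamelBack_time
    (hΘ : IsSpaceTimeTestOn (⊤ : Opens (ℝ × E)) Θ) (hν : 0 < ν) (x : E) :
    Continuous fun s => heatDuhamelBack ν Θ s x :=
  (hΘ.continuous_heatDuhamelBack hν).comp (continuous_id.prodMk continuous_const)

/-- **Spatial derivatives fall on the data**: `U = 𝒰[Θ]` is differentiable in `x` with
`D(𝒰[Θ](s))(x) = 𝒰[DΘ](s)(x)`, the Duhamel integral of the operator-valued test field
`(t, y) ↦ D(Θ t)(y)` (differentiation under the `σ`-integral; for each `σ > 0`,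
`D(e^{νσΔ}g) = e^{νσΔ} Dg` for `g ∈ C¹_c`, tree `hasFDerivAt_heatExtension_of_hasCompactSupport`). [folklore] -/
theorem IsSpaceTimeTestOn.hasFDerivAt_heatDuhamelBack [CompleteSpace F]
    (hΘ : IsSpaceTimeTestOn (⊤ : Opens (ℝ × E)) Θ) (hν : 0 < ν) (s : ℝ) (x : E) :
    HasFDerivAt (heatDuhamelBack ν Θ s)
      (heatDuhamelBack ν (fun t y => fderiv ℝ (Θ t) y) s x) x := by
  set Θ' : ℝ → E → E →L[ℝ] F := fun t y => fderiv ℝ (Θ t) y with hΘ'_def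
  have hΘ' : IsSpaceTimeTestOn (⊤ : Opens (ℝ × E)) Θ' := hΘ.fderiv_top
  obtain ⟨M₁, hM₁0, hM₁⟩ := hΘ'.exists_norm_le
  obtain ⟨a, b, hab⟩ := hΘ.exists_time_support
  have hab' : ∀ t, t ∉ Icc a b → Θ' t = 0 := fun t ht => fderiv_slice_eq_zero_of_eq_zero (hab t ht)
  set L : ℝ := max (b - s) 0 with hL_def
  have hmeas : ∀ x' : E, AEStronglyMeasurable
      (fun σ : ℝ => UnboundedOperators.heatExtension (Θ (s + σ)) (ν * σ) x') (volume.restrict (Ioi 0)) := fun x' =>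
    (hΘ.continuousOn_duhamelIntegrand_right hν s x').aestronglyMeasurable measurableSet_Ioi
  have hmeas' : AEStronglyMeasurable
      (fun σ : ℝ => UnboundedOperators.heatExtension (Θ' (s + σ)) (ν * σ) x) (volume.restrict (Ioi 0)) :=
    (hΘ'.continuousOn_duhamelIntegrand_right hν s x).aestronglyMeasurable measurableSet_Ioi
  have hbound : ∀ᵐ σ ∂(volume.restrict (Ioi (0 : ℝ))), ∀ x' ∈ ball x 1,
      ‖UnboundedOperators.heatExtension (Θ' (s + σ)) (ν * σ) x'‖ ≤ (Ioc (0 : ℝ) L).indicator (fun _ => M₁) σ := by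
    refine (ae_restrict_iff' measurableSet_Ioi).2 (Eventually.of_forall fun σ hσ x' _ => ?_)
    by_cases hσL : σ ≤ L
    · rw [indicator_of_mem (show σ ∈ Ioc (0 : ℝ) L from ⟨hσ, hσL⟩)]
      exact norm_duhamelIntegrand_le hM₁ hν hσ s x'
    · rw [indicator_of_notMem (fun h => hσL h.2), duhamelIntegrand_eq_zero hab' ?_ x', norm_zero]
      exact (le_max_left _ _).trans_lt (not_le.1 hσL)
  have hint : Integrable ((Ioc (0 : ℝ) L).indicator fun _ => M₁) (volume.restrict (Ioi 0)) := by
    refine Integrable.integrableOn ?_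
    refine (integrable_indicator_iff measurableSet_Ioc).2 ?_
    haveI : IsFiniteMeasure (volume.restrict (Ioc (0 : ℝ) L)) :=
      isFiniteMeasure_restrict.2 measure_Ioc_lt_top.ne
    exact integrable_const M₁
  have hdiff : ∀ᵐ σ ∂(volume.restrict (Ioi (0 : ℝ))), ∀ x' ∈ ball x 1,
      HasFDerivAt (fun x'' => UnboundedOperators.heatExtension (Θ (s + σ)) (ν * σ) x'')
        (UnboundedOperators.heatExtension (Θ' (s + σ)) (ν * σ) x') x' :=
    Eventually.of_forall fun σ x' _ =>
      UnboundedOperators.hasFDerivAt_heatExtension_of_hasCompactSupport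
        (contDiff_infty.1 (hΘ.contDiff_slice (s + σ)) 1)
        (hΘ.hasCompactSupport_slice (s + σ)) (ν * σ) x'
  exact hasFDerivAt_integral_of_dominated_of_fderiv_le (ball_mem_nhds x one_pos)
    (Eventually.of_forall hmeas) (hΘ.integrableOn_duhamelIntegrand hν s x) hmeas' hbound hint hdiff

/-- `U(s)` is differentiable in `x`. [folklore] -/
theorem IsSpaceTimeTestOn.differentiable_heatDuhamelBack [CompleteSpace F]
    (hΘ : IsSpaceTimeTestOn (⊤ : Opens (ℝ × E)) Θ) (hν : 0 < ν) (s : ℝ) :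
    Differentiable ℝ (heatDuhamelBack ν Θ s) := fun x =>
  (hΘ.hasFDerivAt_heatDuhamelBack hν s x).differentiableAt

/-- The derivative field of `U = 𝒰[Θ]` is `𝒰[DΘ]`. [folklore] -/
theorem IsSpaceTimeTestOn.fderiv_heatDuhamelBack [CompleteSpace F]
    (hΘ : IsSpaceTimeTestOn (⊤ : Opens (ℝ × E)) Θ) (hν : 0 < ν) (s : ℝ) :
    fderiv ℝ (heatDuhamelBack ν Θ s) = heatDuhamelBack ν (fun t y => fderiv ℝ (Θ t) y) s :=
  funext fun x => (hΘ.hasFDerivAt_heatDuhamelBack hν s x).fderiv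

/-- **Directional derivatives fall on the data**:
`∂ᵥ(𝒰[Θ](s))(x) = 𝒰[∂ᵥΘ](s)(x)`. [folklore] -/
theorem IsSpaceTimeTestOn.fderiv_heatDuhamelBack_apply [CompleteSpace F]
    (hΘ : IsSpaceTimeTestOn (⊤ : Opens (ℝ × E)) Θ) (hν : 0 < ν) (s : ℝ) (x v : E) :
    fderiv ℝ (heatDuhamelBack ν Θ s) x v =
      heatDuhamelBack ν (fun t y => fderiv ℝ (Θ t) y v) s x := by
  have hΘ' : IsSpaceTimeTestOn (⊤ : Opens (ℝ × E)) (fun t y => fderiv ℝ (Θ t) y) := hΘ.fderiv_top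
  rw [hΘ.fderiv_heatDuhamelBack hν s, heatDuhamelBack_apply, heatDuhamelBack_apply,
    ContinuousLinearMap.integral_apply (hΘ'.integrableOn_duhamelIntegrand hν s x) v]
  refine setIntegral_congr_fun measurableSet_Ioi fun σ _ => ?_
  have h := UnboundedOperators.heatExtension_clm_comp (ContinuousLinearMap.apply ℝ F v)
    ((hΘ'.contDiff_slice (s + σ)).continuous) (hΘ'.hasCompactSupport_slice (s + σ)) (ν * σ) x
  simpa using h.symm

/-- `U(s)` is `C¹` in `x`, with derivative field `𝒰[DΘ](s)`. [folklore] -/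
theorem IsSpaceTimeTestOn.contDiff_one_heatDuhamelBack [CompleteSpace F]
    (hΘ : IsSpaceTimeTestOn (⊤ : Opens (ℝ × E)) Θ) (hν : 0 < ν) (s : ℝ) :
    ContDiff ℝ 1 (heatDuhamelBack ν Θ s) := by
  refine contDiff_one_iff_fderiv.2 ⟨hΘ.differentiable_heatDuhamelBack hν s, ?_⟩
  rw [hΘ.fderiv_heatDuhamelBack hν s]
  exact hΘ.fderiv_top.continuous_heatDuhamelBack_space hν s

/-- `U(s)` is `C²` in `x` (two derivatives fall on the data). [folklore] -/
theorem IsSpaceTimeTestOn.contDiff_two_heatDuhamelBack [CompleteSpace F]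
    (hΘ : IsSpaceTimeTestOn (⊤ : Opens (ℝ × E)) Θ) (hν : 0 < ν) (s : ℝ) :
    ContDiff ℝ 2 (heatDuhamelBack ν Θ s) := by
  rw [show (2 : WithTop ℕ∞) = 1 + 1 from rfl, contDiff_succ_iff_fderiv]
  refine ⟨hΘ.differentiable_heatDuhamelBack hν s, fun h => absurd h (by simp), ?_⟩
  rw [hΘ.fderiv_heatDuhamelBack hν s]
  exact hΘ.fderiv_top.contDiff_one_heatDuhamelBack hν s


/-! ### The time derivative of the Duhamel integral -/

omit [NormedAddCommGroup E] [MeasurableSpace E] [BorelSpace E] [FiniteDimensional ℝ E]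
  [InnerProductSpace ℝ E] in
/-- If `Θ(t) = 0` off `[a, b]` then `∂ₜΘ(t) = 0` off `[a, b]` (the complement is open).
[folklore] -/
theorem timeDeriv_eq_zero_of_time_support {a b : ℝ} (hab : ∀ t, t ∉ Icc a b → Θ t = 0)
    {t : ℝ} (ht : t ∉ Icc a b) : timeDeriv Θ t = 0 := by
  funext x
  have hopen : IsOpen (Icc a b)ᶜ := isClosed_Icc.isOpen_compl
  have h1 : (fun s => Θ s x) =ᶠ[𝓝 t] fun _ => (0 : F) := by
    filter_upwards [hopen.mem_nhds ht] with s hs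
    simp [hab s hs]
  rw [timeDeriv, h1.deriv_eq, deriv_const, Pi.zero_apply]

/-- Time derivative of the Duhamel integrand at fixed `σ`:
`∂ₛ (e^{νσΔ} Θ(s + σ))(x) = (e^{νσΔ} ∂ₜΘ(s + σ))(x)` (differentiation under the `y`-integral,
dominated by `‖∂ₜΘ‖_∞ G_{νσ}`). [folklore] -/
theorem IsSpaceTimeTestOn.hasDerivAt_duhamelIntegrand_time
    (hΘ : IsSpaceTimeTestOn (⊤ : Opens (ℝ × E)) Θ) (hν : 0 < ν) {σ : ℝ} (hσ : 0 < σ)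
    (s : ℝ) (x : E) :
    HasDerivAt (fun s' => UnboundedOperators.heatExtension (Θ (s' + σ)) (ν * σ) x)
      (UnboundedOperators.heatExtension (timeDeriv Θ (s + σ)) (ν * σ) x) s := by
  have hΘt : IsSpaceTimeTestOn (⊤ : Opens (ℝ × E)) (timeDeriv Θ) := hΘ.timeDeriv_top
  obtain ⟨Mt, hMt0, hMt⟩ := hΘt.exists_norm_le
  have hα : 0 < ν * σ := mul_pos hν hσ
  have hK : Continuous (UnboundedOperators.heatKernel (E := E) (ν * σ)) := UnboundedOperators.continuous_heatKernel _
  have hmeas : ∀ s', AEStronglyMeasurable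
      (fun y => UnboundedOperators.heatKernel (ν * σ) y • Θ (s' + σ) (x - y)) volume := fun s' =>
    (UnboundedOperators.integrable_heatKernel_smul_comp_sub (hΘ.contDiff_slice _).continuous
      (hΘ.hasCompactSupport_slice _) (ν * σ) x).aestronglyMeasurable
  have key := hasDerivAt_integral_of_dominated_loc_of_deriv_le (μ := (volume : Measure E))
    (F := fun s' y => UnboundedOperators.heatKernel (ν * σ) y • Θ (s' + σ) (x - y))
    (F' := fun s' y => UnboundedOperators.heatKernel (ν * σ) y • timeDeriv Θ (s' + σ) (x - y)) (x₀ := s)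
    (bound := fun y => Mt * UnboundedOperators.heatKernel (ν * σ) y) (ball_mem_nhds s one_pos)
    (Eventually.of_forall hmeas)
    (UnboundedOperators.integrable_heatKernel_smul_comp_sub (hΘ.contDiff_slice _).continuous
      (hΘ.hasCompactSupport_slice _) (ν * σ) x)
    (UnboundedOperators.integrable_heatKernel_smul_comp_sub (hΘt.contDiff_slice _).continuous
      (hΘt.hasCompactSupport_slice _) (ν * σ) x).aestronglyMeasurable ?_
    ((UnboundedOperators.integrable_heatKernel_holds hα).const_mul Mt) ?_
  · have heq : (fun s' => UnboundedOperators.heatExtension (Θ (s' + σ)) (ν * σ) x) =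
        fun s' => ∫ y, UnboundedOperators.heatKernel (ν * σ) y • Θ (s' + σ) (x - y) :=
      funext fun s' => UnboundedOperators.heatExtension_apply _ _ _
    rw [heq, UnboundedOperators.heatExtension_apply]
    exact key.2
  · refine Eventually.of_forall fun y s' _ => ?_
    rw [norm_smul, Real.norm_of_nonneg (UnboundedOperators.heatKernel_pos hα y).le, mul_comm]
    exact mul_le_mul_of_nonneg_right (hMt _ _) (UnboundedOperators.heatKernel_pos hα y).le
  · refine Eventually.of_forall fun y s' _ => ?_
    have h1 : HasDerivAt (fun s'' => Θ (s'' + σ) (x - y)) (timeDeriv Θ (s' + σ) (x - y)) s' := by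
      have h := hΘ.hasDerivAt_time (s' + σ) (x - y)
      simpa using h.comp_add_const s' σ
    exact h1.const_smul (UnboundedOperators.heatKernel (ν * σ) y)

/-- **The time derivative falls on the data**: `s ↦ 𝒰[Θ](s)(x)` is differentiable with
`∂ₛ 𝒰[Θ](s)(x) = 𝒰[∂ₜΘ](s)(x)` (differentiation under the `σ`-integral; in the substituted form
`U(s) = ∫₀^∞ e^{νσΔ} Θ(s + σ) dσ` the domain does not move with `s`). [folklore] -/
theorem IsSpaceTimeTestOn.hasDerivAt_heatDuhamelBack_time
    (hΘ : IsSpaceTimeTestOn (⊤ : Opens (ℝ × E)) Θ) (hν : 0 < ν) (s : ℝ) (x : E) :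
    HasDerivAt (fun s' => heatDuhamelBack ν Θ s' x) (heatDuhamelBack ν (timeDeriv Θ) s x) s := by
  have hΘt : IsSpaceTimeTestOn (⊤ : Opens (ℝ × E)) (timeDeriv Θ) := hΘ.timeDeriv_top
  obtain ⟨Mt, hMt0, hMt⟩ := hΘt.exists_norm_le
  obtain ⟨a, b, hab⟩ := hΘ.exists_time_support
  have habt : ∀ t, t ∉ Icc a b → timeDeriv Θ t = 0 := fun t ht =>
    timeDeriv_eq_zero_of_time_support hab ht
  set L : ℝ := max (b - s + 1) 0 with hL_def
  have hmeas : ∀ s', AEStronglyMeasurable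
      (fun σ : ℝ => UnboundedOperators.heatExtension (Θ (s' + σ)) (ν * σ) x) (volume.restrict (Ioi 0)) := fun s' =>
    (hΘ.continuousOn_duhamelIntegrand_right hν s' x).aestronglyMeasurable measurableSet_Ioi
  have hmeas' : AEStronglyMeasurable
      (fun σ : ℝ => UnboundedOperators.heatExtension (timeDeriv Θ (s + σ)) (ν * σ) x) (volume.restrict (Ioi 0)) :=
    (hΘt.continuousOn_duhamelIntegrand_right hν s x).aestronglyMeasurable measurableSet_Ioi
  have hbound : ∀ᵐ σ ∂(volume.restrict (Ioi (0 : ℝ))), ∀ s' ∈ ball s 1,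
      ‖UnboundedOperators.heatExtension (timeDeriv Θ (s' + σ)) (ν * σ) x‖ ≤
        (Ioc (0 : ℝ) L).indicator (fun _ => Mt) σ := by
    refine (ae_restrict_iff' measurableSet_Ioi).2 (Eventually.of_forall fun σ hσ s' hs' => ?_)
    by_cases hσL : σ ≤ L
    · rw [indicator_of_mem (show σ ∈ Ioc (0 : ℝ) L from ⟨hσ, hσL⟩)]
      exact norm_duhamelIntegrand_le hMt hν hσ s' x
    · rw [indicator_of_notMem (fun h => hσL h.2), duhamelIntegrand_eq_zero habt ?_ x, norm_zero]
      have h1 : b - s + 1 ≤ L := le_max_left _ _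
      have h2 := not_le.1 hσL
      have h3 : dist s' s < 1 := hs'
      rw [Real.dist_eq] at h3
      have h4 := (abs_lt.1 h3).1
      linarith
  have hint : Integrable ((Ioc (0 : ℝ) L).indicator fun _ => Mt) (volume.restrict (Ioi 0)) := by
    refine Integrable.integrableOn ?_
    refine (integrable_indicator_iff measurableSet_Ioc).2 ?_
    haveI : IsFiniteMeasure (volume.restrict (Ioc (0 : ℝ) L)) :=
      isFiniteMeasure_restrict.2 measure_Ioc_lt_top.ne
    exact integrable_const Mt
  have hdiff : ∀ᵐ σ ∂(volume.restrict (Ioi (0 : ℝ))), ∀ s' ∈ ball s 1,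
      HasDerivAt (fun s'' => UnboundedOperators.heatExtension (Θ (s'' + σ)) (ν * σ) x)
        (UnboundedOperators.heatExtension (timeDeriv Θ (s' + σ)) (ν * σ) x) s' :=
    (ae_restrict_iff' measurableSet_Ioi).2 (Eventually.of_forall fun σ hσ s' _ =>
      hΘ.hasDerivAt_duhamelIntegrand_time hν hσ s' x)
  exact (hasDerivAt_integral_of_dominated_loc_of_deriv_le (ball_mem_nhds s one_pos)
    (Eventually.of_forall hmeas) (hΘ.integrableOn_duhamelIntegrand hν s x) hmeas' hbound hint
    hdiff).2

/-- The time derivative of `s ↦ 𝒰[Θ](s)(x)` is `𝒰[∂ₜΘ](s)(x)`. [folklore] -/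
theorem IsSpaceTimeTestOn.deriv_heatDuhamelBack_time
    (hΘ : IsSpaceTimeTestOn (⊤ : Opens (ℝ × E)) Θ) (hν : 0 < ν) (s : ℝ) (x : E) :
    deriv (fun s' => heatDuhamelBack ν Θ s' x) s = heatDuhamelBack ν (timeDeriv Θ) s x :=
  (hΘ.hasDerivAt_heatDuhamelBack_time hν s x).deriv


/-! ### The backward heat equation `∂ₛU + νΔU = -Θ` -/

/-- **Joint differentiability of `(t, α) ↦ (e^{αΔ} Θ(t))(x)` for `α > 0`.** The derivative is
`(dt, dα) ↦ dt • (e^{αΔ} ∂ₜΘ(t))(x) + dα • (e^{αΔ} ΔΘ(t))(x)`: in `t` the derivative falls on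
the data, in `α` it is the heat equation `∂_α e^{αΔ}g = Δ e^{αΔ} g = e^{αΔ} Δg`
(tree `laplacian_heatExtension_eq_integral`, `laplacian_heatExtension_of_hasCompactSupport`).
Proof: dominated differentiation of `∫ G_α(x - y) • Θ(t)(y) dy` in `(t, α)` on
`α' ∈ (α/2, 3α/2)`, with the tree's Gaussian domination of `∂_α G_α`
(`exists_abs_timeWeight_mul_heatKernel_le`) and the compact spatial support of `Θ`. [folklore] -/
theorem IsSpaceTimeTestOn.hasFDerivAt_heatExtension_uncurry [CompleteSpace F]
    (hΘ : IsSpaceTimeTestOn (⊤ : Opens (ℝ × E)) Θ) {α : ℝ} (hα : 0 < α) (t : ℝ) (x : E) :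
    HasFDerivAt (fun p : ℝ × ℝ => UnboundedOperators.heatExtension (Θ p.1) p.2 x)
      ((ContinuousLinearMap.fst ℝ ℝ ℝ).smulRight (UnboundedOperators.heatExtension (timeDeriv Θ t) α x) +
        (ContinuousLinearMap.snd ℝ ℝ ℝ).smulRight (UnboundedOperators.heatExtension (Δ (Θ t)) α x)) (t, α) := by
  have hΘt : IsSpaceTimeTestOn (⊤ : Opens (ℝ × E)) (timeDeriv Θ) := hΘ.timeDeriv_top
  obtain ⟨M, hM0, hM⟩ := hΘ.exists_norm_le
  obtain ⟨Mt, hMt0, hMt⟩ := hΘt.exists_norm_le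
  -- the spatial shadow of the support
  set S : Set E := Prod.snd '' tsupport (uncurry Θ) with hS_def
  have hS : IsCompact S := hΘ.hasCompactSupport.image continuous_snd
  have hΘS : ∀ t' y, y ∉ S → Θ t' y = 0 := fun t' y hy => by
    by_contra h
    exact hy ⟨(t', y), subset_tsupport _ h, rfl⟩
  have hΘtS : ∀ t' y, y ∉ S → timeDeriv Θ t' y = 0 := fun t' y hy =>
    IsSpaceTimeTestOn.timeDeriv_eq_zero_of_notMem fun h => hy ⟨(t', y), h, rfl⟩
  -- notation: time weight and the integrands
  set n : ℝ := (Module.finrank ℝ E : ℝ) with hn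
  set tw : ℝ → E → ℝ := fun β z => ‖z‖ ^ 2 / (4 * β ^ 2) - n / (2 * β) with htw
  set G : ℝ × ℝ → E → F := fun p y => UnboundedOperators.heatKernel p.2 (x - y) • Θ p.1 y with hG
  set G' : ℝ × ℝ → E → (ℝ × ℝ →L[ℝ] F) := fun p y =>
    UnboundedOperators.heatKernel p.2 (x - y) • (ContinuousLinearMap.fst ℝ ℝ ℝ).smulRight (timeDeriv Θ p.1 y) +
      ((tw p.2 (x - y) * UnboundedOperators.heatKernel p.2 (x - y)) • ContinuousLinearMap.snd ℝ ℝ ℝ).smulRight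
        (Θ p.1 y) with hG'
  -- constants for the domination on `α' ∈ [α/2, 2α]`
  obtain ⟨C, hC0, hC⟩ := UnboundedOperators.exists_abs_timeWeight_mul_heatKernel_le (E := E) hα
  set CK : ℝ := (4 * π * (α / 2)) ^ (-n / 2) with hCK
  have hCK0 : 0 ≤ CK := by positivity
  have hKle : ∀ β, α / 2 ≤ β → ∀ z : E, UnboundedOperators.heatKernel β z ≤ CK := fun β hβ z => by
    have hβ0 : 0 < β := by linarith
    refine (UnboundedOperators.heatKernel_le hβ0 z).trans ?_
    exact Real.rpow_le_rpow_of_nonpos (by positivity) (by nlinarith [Real.pi_pos])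
      (by rw [neg_div]; exact neg_nonpos.2 (by positivity))
  have htwle : ∀ β ∈ Icc (α / 2) (2 * α), ∀ z : E, |tw β z| * UnboundedOperators.heatKernel β z ≤ C :=
    fun β hβ z => (hC β hβ z).trans (by
      have : Real.exp (-(1 / (16 * α)) * ‖z‖ ^ 2) ≤ 1 := by
        rw [Real.exp_le_one_iff]
        have : 0 ≤ (1 / (16 * α)) * ‖z‖ ^ 2 := by positivity
        linarith
      nlinarith)
  -- the neighbourhood
  have hball : ∀ p ∈ ball ((t, α) : ℝ × ℝ) (α / 2), p.2 ∈ Icc (α / 2) (2 * α) := fun p hp => by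
    have hp' : dist p (t, α) < α / 2 := hp
    rw [Prod.dist_eq, max_lt_iff] at hp'
    have h2 : dist p.2 α < α / 2 := hp'.2
    rw [Real.dist_eq] at h2
    obtain ⟨h3, h4⟩ := abs_lt.1 h2
    constructor <;> linarith
  -- measurability of `G' (t, α)`: it is continuous in `y`
  have hG'm : AEStronglyMeasurable (G' (t, α)) volume := by
    have hc1 : Continuous fun y : E => UnboundedOperators.heatKernel α (x - y) :=
      (UnboundedOperators.continuous_heatKernel α).comp (continuous_const.sub continuous_id)
    have hc2 : Continuous fun y : E => tw α (x - y) :=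
      (UnboundedOperators.continuous_heatKernel_timeWeight α).comp (continuous_const.sub continuous_id)
    have hc3 : Continuous fun y : E =>
        (ContinuousLinearMap.fst ℝ ℝ ℝ).smulRight (timeDeriv Θ t y) :=
      isBoundedBilinearMap_smulRight.continuous.comp
        (continuous_const.prodMk (hΘt.contDiff_slice t).continuous)
    have hc4 : Continuous fun y : E =>
        ((tw α (x - y) * UnboundedOperators.heatKernel α (x - y)) • ContinuousLinearMap.snd ℝ ℝ ℝ).smulRight
          (Θ t y) :=
      isBoundedBilinearMap_smulRight.continuous.comp
        (((hc2.mul hc1).smul continuous_const).prodMk (hΘ.contDiff_slice t).continuous)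
    exact ((hc1.smul hc3).add hc4).aestronglyMeasurable
  -- the domination on the ball
  have hbd : ∀ y, ∀ p ∈ ball ((t, α) : ℝ × ℝ) (α / 2),
      ‖G' p y‖ ≤ S.indicator (fun _ => CK * Mt + C * M) y := by
    intro y p hp
    have hβ := hball p hp
    have hβ0 : 0 < p.2 := by linarith [hβ.1]
    by_cases hy : y ∈ S
    · rw [indicator_of_mem hy]
      refine ContinuousLinearMap.opNorm_le_bound _ (by positivity) fun v => ?_
      have hv1 : ‖v.1‖ ≤ ‖v‖ := norm_fst_le v
      have hv2 : ‖v.2‖ ≤ ‖v‖ := norm_snd_le v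
      have e0 : G' p y v = UnboundedOperators.heatKernel p.2 (x - y) • (v.1 • timeDeriv Θ p.1 y) +
          ((tw p.2 (x - y) * UnboundedOperators.heatKernel p.2 (x - y)) * v.2) • Θ p.1 y := rfl
      rw [e0]
      have hK := hKle p.2 hβ.1 (x - y)
      have hKpos := (UnboundedOperators.heatKernel_pos hβ0 (x - y)).le
      have htwK := htwle p.2 hβ (x - y)
      have n1 : ‖UnboundedOperators.heatKernel p.2 (x - y) • (v.1 • timeDeriv Θ p.1 y)‖ ≤ ‖v‖ * (CK * Mt) := by
        rw [norm_smul, norm_smul, Real.norm_of_nonneg hKpos]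
        calc UnboundedOperators.heatKernel p.2 (x - y) * (‖v.1‖ * ‖timeDeriv Θ p.1 y‖)
            ≤ CK * (‖v‖ * Mt) := by
              gcongr
              exact hMt _ _
          _ = ‖v‖ * (CK * Mt) := by ring
      have n2 : ‖((tw p.2 (x - y) * UnboundedOperators.heatKernel p.2 (x - y)) * v.2) • Θ p.1 y‖ ≤
          ‖v‖ * (C * M) := by
        rw [norm_smul, norm_mul, norm_mul, Real.norm_eq_abs, Real.norm_of_nonneg hKpos]
        calc |tw p.2 (x - y)| * UnboundedOperators.heatKernel p.2 (x - y) * ‖v.2‖ * ‖Θ p.1 y‖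
            ≤ C * ‖v‖ * M := by
              have h1 : |tw p.2 (x - y)| * UnboundedOperators.heatKernel p.2 (x - y) * ‖v.2‖ ≤ C * ‖v‖ :=
                mul_le_mul htwK hv2 (norm_nonneg _) hC0
              exact mul_le_mul h1 (hM _ _) (norm_nonneg _) (by positivity)
          _ = ‖v‖ * (C * M) := by ring
      calc ‖UnboundedOperators.heatKernel p.2 (x - y) • (v.1 • timeDeriv Θ p.1 y) +
            ((tw p.2 (x - y) * UnboundedOperators.heatKernel p.2 (x - y)) * v.2) • Θ p.1 y‖
          ≤ ‖v‖ * (CK * Mt) + ‖v‖ * (C * M) := (norm_add_le _ _).trans (add_le_add n1 n2)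
        _ = (CK * Mt + C * M) * ‖v‖ := by ring
    · rw [indicator_of_notMem hy]
      have h1 : timeDeriv Θ p.1 y = 0 := hΘtS p.1 y hy
      have h2 : Θ p.1 y = 0 := hΘS p.1 y hy
      refine ContinuousLinearMap.opNorm_le_bound _ le_rfl fun v => ?_
      have e0 : G' p y v = UnboundedOperators.heatKernel p.2 (x - y) • (v.1 • timeDeriv Θ p.1 y) +
          ((tw p.2 (x - y) * UnboundedOperators.heatKernel p.2 (x - y)) * v.2) • Θ p.1 y := rfl
      rw [e0, h1, h2]
      simp
  -- integrability of the bound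
  have hbi : Integrable (S.indicator fun _ => CK * Mt + C * M) volume := by
    refine (integrable_indicator_iff hS.measurableSet).2 ?_
    haveI : IsFiniteMeasure (volume.restrict S) := isFiniteMeasure_restrict.2 hS.measure_lt_top.ne
    exact integrable_const _
  have hG'i : Integrable (G' (t, α)) volume :=
    hbi.mono' hG'm (Eventually.of_forall fun y => hbd y (t, α) (mem_ball_self (half_pos hα)))
  -- dominated differentiation
  have key := hasFDerivAt_integral_of_dominated_of_fderiv_le (μ := (volume : Measure E))
    (F := G) (F' := G') (x₀ := (t, α)) (bound := S.indicator fun _ => CK * Mt + C * M)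
    (ball_mem_nhds _ (half_pos hα)) ?_ ?_ hG'm (Eventually.of_forall hbd) hbi ?_
  · -- identify the derivative
    have heq : (fun p : ℝ × ℝ => UnboundedOperators.heatExtension (Θ p.1) p.2 x) = fun p => ∫ y, G p y :=
      funext fun p => UnboundedOperators.heatExtension_eq_integral_sub _ _ _
    rw [heq]
    refine key.congr_fderiv (ContinuousLinearMap.ext fun v => ?_)
    rw [ContinuousLinearMap.integral_apply hG'i v]
    -- the two pieces
    have i1 : Integrable (fun y => UnboundedOperators.heatKernel α (x - y) • timeDeriv Θ t y) volume :=
      (((UnboundedOperators.continuous_heatKernel α).comp (continuous_const.sub continuous_id)).smul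
        (hΘt.contDiff_slice t).continuous).integrable_of_hasCompactSupport
        (hΘt.hasCompactSupport_slice t).smul_left
    have i2 : Integrable (fun y => (tw α (x - y) * UnboundedOperators.heatKernel α (x - y)) • Θ t y) volume :=
      ((((UnboundedOperators.continuous_heatKernel_timeWeight α).comp (continuous_const.sub continuous_id)).mul
        ((UnboundedOperators.continuous_heatKernel α).comp (continuous_const.sub continuous_id))).smul
        (hΘ.contDiff_slice t).continuous).integrable_of_hasCompactSupport
        (hΘ.hasCompactSupport_slice t).smul_left
    have hpt : ∀ y, G' (t, α) y v = v.1 • (UnboundedOperators.heatKernel α (x - y) • timeDeriv Θ t y) +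
        v.2 • ((tw α (x - y) * UnboundedOperators.heatKernel α (x - y)) • Θ t y) := fun y => by
      have e0 : G' (t, α) y v = UnboundedOperators.heatKernel α (x - y) • (v.1 • timeDeriv Θ t y) +
          ((tw α (x - y) * UnboundedOperators.heatKernel α (x - y)) * v.2) • Θ t y := rfl
      rw [e0, smul_comm (UnboundedOperators.heatKernel α (x - y)) v.1,
        mul_comm (tw α (x - y) * UnboundedOperators.heatKernel α (x - y)) v.2, mul_smul]
    simp_rw [hpt]
    have i1' : Integrable (fun y => v.1 • (UnboundedOperators.heatKernel α (x - y) • timeDeriv Θ t y)) volume :=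
      i1.smul v.1
    have i2' : Integrable (fun y => v.2 • ((tw α (x - y) * UnboundedOperators.heatKernel α (x - y)) • Θ t y))
        volume := i2.smul v.2
    rw [integral_add i1' i2', integral_smul, integral_smul,
      ← UnboundedOperators.heatExtension_eq_integral_sub, ← UnboundedOperators.laplacian_heatExtension_eq_integral hα
        ((hΘ.contDiff_slice t).continuous.memLp_top_of_hasCompactSupport
          (hΘ.hasCompactSupport_slice t) volume) le_top,
      UnboundedOperators.laplacian_heatExtension_of_hasCompactSupport (contDiff_infty.1 (hΘ.contDiff_slice t) 2)
        (hΘ.hasCompactSupport_slice t)]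
    rfl
  · exact Eventually.of_forall fun p =>
      (((UnboundedOperators.continuous_heatKernel p.2).comp (continuous_const.sub continuous_id)).smul
        (hΘ.contDiff_slice p.1).continuous).aestronglyMeasurable
  · exact (((UnboundedOperators.continuous_heatKernel α).comp (continuous_const.sub continuous_id)).smul
      (hΘ.contDiff_slice t).continuous).integrable_of_hasCompactSupport
      (hΘ.hasCompactSupport_slice t).smul_left
  · -- pointwise differentiability on the ball
    refine Eventually.of_forall fun y p hp => ?_
    have hβ0 : 0 < p.2 := by linarith [(hball p hp).1]
    have hK : HasFDerivAt (fun q : ℝ × ℝ => UnboundedOperators.heatKernel q.2 (x - y))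
        ((tw p.2 (x - y) * UnboundedOperators.heatKernel p.2 (x - y)) • ContinuousLinearMap.snd ℝ ℝ ℝ) p :=
      (UnboundedOperators.hasDerivAt_heatKernel_time hβ0 (x - y)).comp_hasFDerivAt p hasFDerivAt_snd
    have hT : HasFDerivAt (fun q : ℝ × ℝ => Θ q.1 y)
        ((ContinuousLinearMap.fst ℝ ℝ ℝ).smulRight (timeDeriv Θ p.1 y)) p := by
      have h := ((hΘ.hasDerivAt_time p.1 y).hasFDerivAt).comp p hasFDerivAt_fst
      refine h.congr_fderiv (ContinuousLinearMap.ext fun v => ?_)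
      simp
    exact hK.smul hT


/-- **The `σ`-derivative of the Duhamel integrand** at `σ > 0`:
`∂_σ (e^{νσΔ} Θ(s + σ))(x) = (e^{νσΔ} ∂ₜΘ(s + σ))(x) + ν (e^{νσΔ} ΔΘ(s + σ))(x)` (chain rule
along `σ ↦ (s + σ, νσ)` in `hasFDerivAt_heatExtension_uncurry`). [folklore] -/
theorem IsSpaceTimeTestOn.hasDerivAt_duhamelIntegrand_sigma [CompleteSpace F]
    (hΘ : IsSpaceTimeTestOn (⊤ : Opens (ℝ × E)) Θ) (hν : 0 < ν) (s : ℝ) {σ : ℝ} (hσ : 0 < σ)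
    (x : E) :
    HasDerivAt (fun σ' => UnboundedOperators.heatExtension (Θ (s + σ')) (ν * σ') x)
      (UnboundedOperators.heatExtension (timeDeriv Θ (s + σ)) (ν * σ) x +
        ν • UnboundedOperators.heatExtension (Δ (Θ (s + σ))) (ν * σ) x) σ := by
  have h1 := hΘ.hasFDerivAt_heatExtension_uncurry (mul_pos hν hσ) (s + σ) x
  have h2 : HasDerivAt (fun σ' : ℝ => ((s + σ', ν * σ') : ℝ × ℝ)) ((1 : ℝ), ν) σ := by
    refine HasDerivAt.prodMk ?_ ?_
    · simpa using (hasDerivAt_id σ).const_add s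
    · simpa using (hasDerivAt_id σ).const_mul ν
  have h3 := h1.comp_hasDerivAt σ h2
  have hval : ((ContinuousLinearMap.fst ℝ ℝ ℝ).smulRight (UnboundedOperators.heatExtension (timeDeriv Θ (s + σ)) (ν * σ) x) +
      (ContinuousLinearMap.snd ℝ ℝ ℝ).smulRight (UnboundedOperators.heatExtension (Δ (Θ (s + σ))) (ν * σ) x))
        ((1 : ℝ), ν) =
      UnboundedOperators.heatExtension (timeDeriv Θ (s + σ)) (ν * σ) x +
        ν • UnboundedOperators.heatExtension (Δ (Θ (s + σ))) (ν * σ) x := by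
    simp [ContinuousLinearMap.smulRight_apply]
  rw [hval] at h3
  exact h3

/-- **The backward heat equation for the Duhamel integral**:
`𝒰[∂ₜΘ](s)(x) + ν 𝒰[ΔΘ](s)(x) = -Θ(s)(x)`, i.e. `∂ₛU + νΔU = -Θ` with
`∂ₛU = 𝒰[∂ₜΘ]` (`hasDerivAt_heatDuhamelBack_time`) and `ΔU = 𝒰[ΔΘ]`
(`laplacian_heatDuhamelBack`). Proof: `σ ↦ (e^{νσΔ}Θ(s + σ))(x)` extends continuously to
`σ = 0` with value `Θ(s)(x)` (scaled representation), vanishes for large `σ`, and has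
derivative the integrand of the left-hand side on `σ > 0`; integrate over `(0, ∞)`
(`MeasureTheory.integral_Ioi_of_hasDerivAt_of_tendsto`). (Lemarié-Rieusset 2016, Prop. 4.3,
proof of (B): `∂ₜU = νΔU + div g`.) [folklore] -/
theorem IsSpaceTimeTestOn.heatDuhamelBack_backward_heat [CompleteSpace F]
    (hΘ : IsSpaceTimeTestOn (⊤ : Opens (ℝ × E)) Θ) (hν : 0 < ν) (s : ℝ) (x : E) :
    heatDuhamelBack ν (timeDeriv Θ) s x + ν • heatDuhamelBack ν (fun t => Δ (Θ t)) s x =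
      -Θ s x := by
  have hΘt : IsSpaceTimeTestOn (⊤ : Opens (ℝ × E)) (timeDeriv Θ) := hΘ.timeDeriv_top
  have hΘl : IsSpaceTimeTestOn (⊤ : Opens (ℝ × E)) (fun t => Δ (Θ t)) := hΘ.laplacian_top
  set f : ℝ → F := fun σ => ∫ z, UnboundedOperators.heatKernel 1 z • Θ (s + σ) (x - Real.sqrt (ν * σ) • z)
    with hf_def
  set f' : ℝ → F := fun σ => UnboundedOperators.heatExtension (timeDeriv Θ (s + σ)) (ν * σ) x +
    ν • UnboundedOperators.heatExtension (Δ (Θ (s + σ))) (ν * σ) x with hf'_def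
  have hcf : Continuous fun σ : ℝ => ((s, σ, x) : ℝ × ℝ × E) := by fun_prop
  have hf_cont : Continuous f := (hΘ.continuous_scaledIntegrand ν).comp hcf
  have hf_eq : ∀ σ, 0 < σ → f σ = UnboundedOperators.heatExtension (Θ (s + σ)) (ν * σ) x := fun σ hσ =>
    (duhamelIntegrand_eq_scaled hν hσ s x).symm
  have hf0 : f 0 = Θ s x := by
    have h := UnboundedOperators.integral_heatKernel_one_smul_of_nonpos le_rfl (Θ s) x
    simpa [hf_def] using h
  have hderiv : ∀ σ ∈ Ioi (0 : ℝ), HasDerivAt f (f' σ) σ := fun σ hσ => by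
    have h := hΘ.hasDerivAt_duhamelIntegrand_sigma hν s hσ x
    refine h.congr_of_eventuallyEq ?_
    filter_upwards [Ioi_mem_nhds hσ] with σ' hσ' using hf_eq σ' hσ'
  have i1 := hΘt.integrableOn_duhamelIntegrand hν s x
  have i2 := hΘl.integrableOn_duhamelIntegrand hν s x
  have hf'int : IntegrableOn f' (Ioi 0) volume := i1.add (i2.smul ν)
  have hlim : Tendsto f atTop (𝓝 0) := by
    obtain ⟨a, b, hab⟩ := hΘ.exists_time_support
    refine tendsto_const_nhds.congr' ?_
    filter_upwards [eventually_gt_atTop (max (b - s) 0)] with σ hσ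
    have hσ0 : 0 < σ := (le_max_right _ _).trans_lt hσ
    rw [hf_eq σ hσ0, duhamelIntegrand_eq_zero hab ((le_max_left _ _).trans_lt hσ) x]
  have key := integral_Ioi_of_hasDerivAt_of_tendsto hf_cont.continuousWithinAt hderiv hf'int hlim
  rw [hf0, zero_sub] at key
  have i2' : IntegrableOn (fun σ => ν • UnboundedOperators.heatExtension (Δ (Θ (s + σ))) (ν * σ) x) (Ioi 0) volume :=
    i2.smul ν
  rw [← key, heatDuhamelBack_apply, heatDuhamelBack_apply, ← integral_smul, ← integral_add i1 i2']


/-! ### Linearity, the Laplacian, and integrability in space -/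

/-- Linearity of the Duhamel integral over finite sums of space–time test fields. [folklore] -/
theorem heatDuhamelBack_finset_sum {ι : Type*} (S : Finset ι) {g : ι → ℝ → E → F}
    (hg : ∀ i ∈ S, IsSpaceTimeTestOn (⊤ : Opens (ℝ × E)) (g i)) (hν : 0 < ν) (s : ℝ) (x : E) :
    heatDuhamelBack ν (fun t y => ∑ i ∈ S, g i t y) s x = ∑ i ∈ S, heatDuhamelBack ν (g i) s x := by
  simp only [heatDuhamelBack_apply]
  rw [← integral_finsetSum S fun i hi => (hg i hi).integrableOn_duhamelIntegrand hν s x]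
  refine setIntegral_congr_fun measurableSet_Ioi fun σ _ => ?_
  exact UnboundedOperators.heatExtension_finset_sum S (ν * σ) x fun i hi =>
    UnboundedOperators.integrable_heatKernel_smul_comp_sub ((hg i hi).contDiff_slice _).continuous
      ((hg i hi).hasCompactSupport_slice _) _ x

/-- **The Laplacian falls on the data**: `Δ(𝒰[Θ](s))(x) = 𝒰[ΔΘ](s)(x)` (two directional
derivatives fall on the data, `fderiv_heatDuhamelBack_apply`, summed over an orthonormal frame).
[folklore] -/
theorem IsSpaceTimeTestOn.laplacian_heatDuhamelBack [CompleteSpace F]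
    (hΘ : IsSpaceTimeTestOn (⊤ : Opens (ℝ × E)) Θ) (hν : 0 < ν) (s : ℝ) (x : E) :
    (Δ (heatDuhamelBack ν Θ s)) x = heatDuhamelBack ν (fun t => Δ (Θ t)) s x := by
  set b := stdOrthonormalBasis ℝ E
  rw [laplacian_eq_sum_fderiv_fderiv_normed b (hΘ.contDiff_two_heatDuhamelBack hν s) x]
  have h1 : ∀ i, (fun y => fderiv ℝ (heatDuhamelBack ν Θ s) y (b i)) =
      heatDuhamelBack ν (fun t y => fderiv ℝ (Θ t) y (b i)) s := fun i =>
    funext fun y => hΘ.fderiv_heatDuhamelBack_apply hν s y (b i)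
  have h2 : ∀ i, fderiv ℝ (fun y => fderiv ℝ (heatDuhamelBack ν Θ s) y (b i)) x (b i) =
      heatDuhamelBack ν (fun t y => fderiv ℝ (fun z => fderiv ℝ (Θ t) z (b i)) y (b i)) s x :=
    fun i => by
    rw [h1 i]
    exact (hΘ.fderiv_apply_top (b i)).fderiv_heatDuhamelBack_apply hν s x (b i)
  simp_rw [h2]
  rw [← heatDuhamelBack_finset_sum Finset.univ
    (fun i _ => (hΘ.fderiv_apply_top (b i)).fderiv_apply_top (b i)) hν s x]
  congr 1
  funext t y
  exact (laplacian_eq_sum_fderiv_fderiv_normed b (contDiff_infty.1 (hΘ.contDiff_slice t) 2) y).symm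

/-- `L¹` norms of the slices of a space–time test field are uniformly bounded. [folklore] -/
theorem IsSpaceTimeTestOn.exists_integral_norm_slice_le
    (hΘ : IsSpaceTimeTestOn (⊤ : Opens (ℝ × E)) Θ) :
    ∃ M₁ : ℝ, 0 ≤ M₁ ∧ ∀ t, ∫ y, ‖Θ t y‖ ≤ M₁ := by
  obtain ⟨M, hM0, hM⟩ := hΘ.exists_norm_le
  set S : Set E := Prod.snd '' tsupport (uncurry Θ) with hS_def
  have hS : IsCompact S := hΘ.hasCompactSupport.image continuous_snd
  have hΘS : ∀ t y, y ∉ S → Θ t y = 0 := fun t y hy => by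
    by_contra h
    exact hy ⟨(t, y), subset_tsupport _ h, rfl⟩
  refine ⟨M * (volume S).toReal, by positivity, fun t => ?_⟩
  have hle : ∀ y, ‖Θ t y‖ ≤ S.indicator (fun _ => M) y := fun y => by
    by_cases hy : y ∈ S
    · rw [indicator_of_mem hy]; exact hM t y
    · rw [indicator_of_notMem hy, hΘS t y hy, norm_zero]
  calc ∫ y, ‖Θ t y‖ ≤ ∫ y, S.indicator (fun _ => M) y := by
        refine integral_mono_of_nonneg (Eventually.of_forall fun y => norm_nonneg _) ?_
          (Eventually.of_forall hle)
        refine (integrable_indicator_iff hS.measurableSet).2 ?_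
        haveI : IsFiniteMeasure (volume.restrict S) :=
          isFiniteMeasure_restrict.2 hS.measure_lt_top.ne
        exact integrable_const _
    _ = M * (volume S).toReal := by
        rw [integral_indicator hS.measurableSet, setIntegral_const, smul_eq_mul, mul_comm]
        rfl

/-- `L¹` contraction of the caloric extension for continuous compactly supported data:
`e^{αΔ} g` is integrable with `∫ ‖e^{αΔ} g‖ ≤ ∫ ‖g‖`. [folklore] -/
theorem integral_norm_heatExtension_le [CompleteSpace F] {g : E → F} (hg : Continuous g)
    (hc : HasCompactSupport g) {α : ℝ} (hα : 0 < α) :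
    Integrable (UnboundedOperators.heatExtension g α) volume ∧ ∫ x, ‖UnboundedOperators.heatExtension g α x‖ ≤ ∫ x, ‖g x‖ := by
  have hgi : Integrable g volume := hg.integrable_of_hasCompactSupport hc
  have hi : Integrable (UnboundedOperators.heatExtension g α) volume := UnboundedOperators.integrable_heatExtension hgi hα
  refine ⟨hi, ?_⟩
  rw [integral_norm_eq_lintegral_enorm hi.aestronglyMeasurable,
    integral_norm_eq_lintegral_enorm hgi.aestronglyMeasurable]
  exact ENNReal.toReal_mono (hgi.2.ne) (UnboundedOperators.lintegral_enorm_heatExtension_le hgi hα)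

/-- **Integrability in space**: `x ↦ 𝒰[Θ](s)(x)` is integrable, with
`∫ ‖𝒰[Θ](s)‖ ≤ (b - s)₊ · sup_t ‖Θ(t)‖_{L¹}` (Tonelli over `(x, σ)` and the `L¹` contraction of
`e^{νσΔ}`). [folklore] -/
theorem IsSpaceTimeTestOn.integrable_heatDuhamelBack [CompleteSpace F]
    (hΘ : IsSpaceTimeTestOn (⊤ : Opens (ℝ × E)) Θ) (hν : 0 < ν) (s : ℝ) :
    Integrable (heatDuhamelBack ν Θ s) volume := by
  obtain ⟨M₁, hM₁0, hM₁⟩ := hΘ.exists_integral_norm_slice_le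
  obtain ⟨a, b, hab⟩ := hΘ.exists_time_support
  set L : ℝ := max (b - s) 0 with hL_def
  -- the integrand on `E × (0, ∞)`
  set Φ : E × ℝ → F := fun q => UnboundedOperators.heatExtension (Θ (s + q.2)) (ν * q.2) q.1 with hΦ_def
  have hmeasΦ : AEStronglyMeasurable Φ ((volume : Measure E).prod (volume.restrict (Ioi (0 : ℝ)))) := by
    have hc : ContinuousOn Φ (univ ×ˢ Ioi 0) := by
      have hcq : Continuous fun q : E × ℝ => ((s, q.2, q.1) : ℝ × ℝ × E) := by fun_prop
      have h := ContinuousOn.comp (g := fun p : ℝ × ℝ × E =>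
          UnboundedOperators.heatExtension (Θ (p.1 + p.2.1)) (ν * p.2.1) p.2.2)
        (f := fun q : E × ℝ => ((s, q.2, q.1) : ℝ × ℝ × E)) (s := univ ×ˢ Ioi 0)
        (hΘ.continuousOn_duhamelIntegrand hν) hcq.continuousOn (fun q hq => show 0 < q.2 from hq.2)
      simpa only [Function.comp_def] using h
    have h := hc.aestronglyMeasurable (μ := (volume : Measure E).prod (volume : Measure ℝ))
      (MeasurableSet.univ.prod measurableSet_Ioi)
    have hμ : ((volume : Measure E).prod (volume : Measure ℝ)).restrict (univ ×ˢ Ioi 0) =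
        (volume : Measure E).prod (volume.restrict (Ioi (0 : ℝ))) := by
      rw [← Measure.prod_restrict, Measure.restrict_univ]
    rwa [hμ] at h
  have hint : Integrable Φ ((volume : Measure E).prod (volume.restrict (Ioi (0 : ℝ)))) := by
    rw [integrable_prod_iff' hmeasΦ]
    constructor
    · refine (ae_restrict_iff' measurableSet_Ioi).2 (Eventually.of_forall fun σ hσ => ?_)
      exact (integral_norm_heatExtension_le (hΘ.contDiff_slice (s + σ)).continuous
        (hΘ.hasCompactSupport_slice (s + σ)) (mul_pos hν hσ)).1
    · -- `σ ↦ ∫ ‖Φ(x, σ)‖ dx` is bounded by `M₁` on `(0, L]` and vanishes beyond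
      have hmeas1 : AEStronglyMeasurable (fun σ => ∫ x, ‖Φ (x, σ)‖)
          (volume.restrict (Ioi (0 : ℝ))) :=
        hmeasΦ.norm.prod_swap.integral_prod_right'
      have hbd : ∀ᵐ σ ∂(volume.restrict (Ioi (0 : ℝ))), ‖∫ x, ‖Φ (x, σ)‖‖ ≤
          (Ioc (0 : ℝ) L).indicator (fun _ => M₁) σ := by
        refine (ae_restrict_iff' measurableSet_Ioi).2 (Eventually.of_forall fun σ hσ => ?_)
        rw [Real.norm_of_nonneg (integral_nonneg fun _ => norm_nonneg _)]
        by_cases hσL : σ ≤ L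
        · rw [indicator_of_mem (show σ ∈ Ioc (0 : ℝ) L from ⟨hσ, hσL⟩)]
          exact (integral_norm_heatExtension_le (hΘ.contDiff_slice (s + σ)).continuous
            (hΘ.hasCompactSupport_slice (s + σ)) (mul_pos hν hσ)).2.trans (hM₁ (s + σ))
        · rw [indicator_of_notMem (fun h => hσL h.2)]
          have h0 : ∀ x, Φ (x, σ) = 0 := fun x =>
            duhamelIntegrand_eq_zero hab ((le_max_left _ _).trans_lt (not_le.1 hσL)) x
          simp [h0]
      have hinti : Integrable ((Ioc (0 : ℝ) L).indicator fun _ => M₁) (volume.restrict (Ioi 0)) := by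
        refine Integrable.integrableOn ?_
        refine (integrable_indicator_iff measurableSet_Ioc).2 ?_
        haveI : IsFiniteMeasure (volume.restrict (Ioc (0 : ℝ) L)) :=
          isFiniteMeasure_restrict.2 measure_Ioc_lt_top.ne
        exact integrable_const M₁
      exact hinti.mono' hmeas1 hbd
  have h := hint.integral_prod_left
  exact h

/-- `𝒰[Θ](s)` is square integrable in space (it is bounded and integrable). [folklore] -/
theorem IsSpaceTimeTestOn.memLp_two_heatDuhamelBack [CompleteSpace F]
    (hΘ : IsSpaceTimeTestOn (⊤ : Opens (ℝ × E)) Θ) (hν : 0 < ν) (s : ℝ) :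
    MemLp (heatDuhamelBack ν Θ s) 2 volume := by
  obtain ⟨M, hM0, hM⟩ := hΘ.exists_norm_le
  obtain ⟨a, b, hab⟩ := hΘ.exists_time_support
  set C : ℝ := M * max (b - s) 0 with hC_def
  have hbd : ∀ x, ‖heatDuhamelBack ν Θ s x‖ ≤ C := fun x => hΘ.norm_heatDuhamelBack_le hν hM hab s x
  have hi := hΘ.integrable_heatDuhamelBack hν s
  rw [memLp_two_iff_integrable_sq_norm hi.aestronglyMeasurable]
  refine (hi.norm.const_mul C).mono' ?_ (Eventually.of_forall fun x => ?_)
  · exact (continuous_norm.comp (hΘ.continuous_heatDuhamelBack_space hν s)).pow 2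
      |>.aestronglyMeasurable
  · rw [Real.norm_of_nonneg (sq_nonneg _), sq]
    exact mul_le_mul_of_nonneg_right (hbd x) (norm_nonneg _)


end Duhamel

end Literature.Analysis.FluidPDE
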